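import Literature.MathematicalPhysics.KineticTheory.HardSphereEulerProofs
import Mathlib.Analysis.Complex.Exponential
import Mathlib.Probability.Moments.Basic

/-!
# Exponential (Chernoff) bounds for averages of independent variables with exponential moments

Helper file for item `LocalGibbsConcentrationDilute` (stmt-AtomisticToContinuum-13460) of route
`JaynesSqueeze`: the velocity part of the exponential law of large numbers for local Gibbs states.

* `exp_le_one_add_add_sq_mul_exp_abs`: `eˣ ≤ 1 + x + x² e^{|x|}`.
* `integral_exp_mul_le_exp`: for a centred real variable `X` on a probability space with a uniform
  exponential moment `∫ e^{t₀|X|} ≤ B`, the moment generating function satisfies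
  `∫ e^{tX} ≤ exp(8 B t²/t₀²)` for `|t| ≤ t₀/2`.
* `pi_measure_sum_ge_le_exp`, `pi_measure_avg_abs_ge_le_exp`: on a finite product of probability
  spaces, an average of independent centred variables with uniform exponential moments has
  exponentially small tails, `P(δ ≤ |n⁻¹ ∑ Xᵢ|) ≤ 2 exp(-κ n)` with the explicit rate
  `κ = δ/2 · min(t₀/2, δ t₀²/(16 B))`.

No definitions (pure-proof helper file). prover-pitem-stmt-AtomisticToContinuum-13460-0.
-/

noncomputable section

namespace Summit.AtomisticToContinuum.HydrodynamicLimit.Theorems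

open MeasureTheory ProbabilityTheory Filter Topology Set
open scoped ENNReal

namespace LocalGibbsConcentration

section ScalarInequalities

/-- `eˣ ≤ 1 + x + x² e^{|x|}` (second-order Taylor bound of the exponential, from Mathlib's
complex estimate `‖exp x - ∑_{m<2} xᵐ/m!‖ ≤ ‖x‖² exp ‖x‖`). [folklore] -/
theorem exp_le_one_add_add_sq_mul_exp_abs (x : ℝ) :
    Real.exp x ≤ 1 + x + x ^ 2 * Real.exp |x| := by
  have h := Complex.norm_exp_sub_sum_le_norm_mul_exp (x : ℂ) 2
  have h2 : (∑ m ∈ Finset.range 2, (x : ℂ) ^ m / (m.factorial : ℂ)) = ((1 + x : ℝ) : ℂ) := by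
    simp [Finset.sum_range_succ]
  rw [h2, ← Complex.ofReal_exp, ← Complex.ofReal_sub, Complex.norm_real, Complex.norm_real,
    Real.norm_eq_abs, Real.norm_eq_abs, sq_abs] at h
  have h3 := (abs_le.1 h).2
  linarith

/-- `x² ≤ (8/t₀²) e^{t₀|x|/2}` for `t₀ > 0` (from `y²/2 ≤ eʸ`, `y = t₀|x|/2 ≥ 0`). [folklore] -/
theorem sq_le_div_mul_exp {t₀ : ℝ} (ht₀ : 0 < t₀) (x : ℝ) :
    x ^ 2 ≤ 8 / t₀ ^ 2 * Real.exp (t₀ * |x| / 2) := by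
  have hy : 0 ≤ t₀ * |x| / 2 := by positivity
  have h := Real.sum_le_exp_of_nonneg hy 3
  have hs : (∑ i ∈ Finset.range 3, (t₀ * |x| / 2) ^ i / (i.factorial : ℝ)) =
      1 + t₀ * |x| / 2 + (t₀ * |x| / 2) ^ 2 / 2 := by
    simp [Finset.sum_range_succ, Nat.factorial]
  rw [hs] at h
  have hsq : (t₀ * |x| / 2) ^ 2 / 2 ≤ Real.exp (t₀ * |x| / 2) := by nlinarith [abs_nonneg x]
  have ht2 : 0 < t₀ ^ 2 := by positivity
  rw [div_mul_eq_mul_div, le_div_iff₀ ht2]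
  have : (t₀ * |x| / 2) ^ 2 / 2 = t₀ ^ 2 * x ^ 2 / 8 := by rw [← sq_abs x]; ring
  rw [this] at hsq
  linarith

/-- For `|t| ≤ t₀/2`: `e^{tx} ≤ 1 + t x + (8 t²/t₀²) e^{t₀ |x|}`. [folklore] -/
theorem exp_mul_le_of_abs_le {t₀ t : ℝ} (ht₀ : 0 < t₀) (ht : |t| ≤ t₀ / 2) (x : ℝ) :
    Real.exp (t * x) ≤ 1 + t * x + 8 / t₀ ^ 2 * t ^ 2 * Real.exp (t₀ * |x|) := by
  have h1 := exp_le_one_add_add_sq_mul_exp_abs (t * x)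
  have h2 : Real.exp |t * x| ≤ Real.exp (t₀ * |x| / 2) := by
    rw [Real.exp_le_exp, abs_mul]
    have := mul_le_mul_of_nonneg_right ht (abs_nonneg x)
    linarith
  have h3 := sq_le_div_mul_exp ht₀ x
  have h4 : (t * x) ^ 2 * Real.exp |t * x| ≤ 8 / t₀ ^ 2 * t ^ 2 * Real.exp (t₀ * |x|) := by
    calc (t * x) ^ 2 * Real.exp |t * x|
        ≤ (t ^ 2 * (8 / t₀ ^ 2 * Real.exp (t₀ * |x| / 2))) * Real.exp (t₀ * |x| / 2) := by
          rw [mul_pow]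
          exact mul_le_mul (mul_le_mul_of_nonneg_left h3 (sq_nonneg t)) h2 (Real.exp_nonneg _)
            (by positivity)
      _ = 8 / t₀ ^ 2 * t ^ 2 * (Real.exp (t₀ * |x| / 2) * Real.exp (t₀ * |x| / 2)) := by ring
      _ = 8 / t₀ ^ 2 * t ^ 2 * Real.exp (t₀ * |x|) := by rw [← Real.exp_add]; ring_nf
  linarith

/-- `|x| ≤ t₀⁻¹ e^{t₀|x|}` for `t₀ > 0`. [folklore] -/
theorem abs_le_inv_mul_exp {t₀ : ℝ} (ht₀ : 0 < t₀) (x : ℝ) : |x| ≤ t₀⁻¹ * Real.exp (t₀ * |x|) := by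
  have h := Real.add_one_le_exp (t₀ * |x|)
  rw [le_inv_mul_iff₀ ht₀]
  linarith

end ScalarInequalities

section OneVariable

variable {V : Type*} [MeasurableSpace V]

/-- **Moment generating function bound from a uniform exponential moment.** For a centred real
variable `X` on a probability space with `∫ e^{t₀|X|} ≤ B`:
`∫ e^{tX} ≤ exp(8 B t²/t₀²)` for `|t| ≤ t₀/2`. [folklore] -/
theorem integral_exp_mul_le_exp (μ : Measure V) [IsProbabilityMeasure μ] {X : V → ℝ}
    (hXm : AEStronglyMeasurable X μ) {t₀ B : ℝ} (ht₀ : 0 < t₀)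
    (hint : Integrable (fun v => Real.exp (t₀ * |X v|)) μ)
    (hB : ∫ v, Real.exp (t₀ * |X v|) ∂μ ≤ B) (h0 : ∫ v, X v ∂μ = 0) {t : ℝ} (ht : |t| ≤ t₀ / 2) :
    ∫ v, Real.exp (t * X v) ∂μ ≤ Real.exp (8 * B / t₀ ^ 2 * t ^ 2) := by
  have hXint : Integrable X μ := by
    refine (hint.const_mul t₀⁻¹).mono' hXm (Eventually.of_forall fun v => ?_)
    rw [Real.norm_eq_abs]
    exact abs_le_inv_mul_exp ht₀ (X v)
  have hdom : Integrable (fun v => 1 + t * X v + 8 / t₀ ^ 2 * t ^ 2 * Real.exp (t₀ * |X v|)) μ :=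
    ((integrable_const 1).add (hXint.const_mul t)).add (hint.const_mul _)
  have hexp_int : Integrable (fun v => Real.exp (t * X v)) μ := by
    refine hint.mono' ?_ (Eventually.of_forall fun v => ?_)
    · exact (Real.continuous_exp.comp_aestronglyMeasurable (hXm.const_mul t))
    · rw [Real.norm_eq_abs, abs_of_pos (Real.exp_pos _), Real.exp_le_exp]
      calc t * X v ≤ |t * X v| := le_abs_self _
        _ = |t| * |X v| := abs_mul t (X v)
        _ ≤ t₀ * |X v| := by
            refine mul_le_mul_of_nonneg_right ?_ (abs_nonneg _)
            linarith [abs_nonneg t]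
  have i1 : Integrable (fun v => (1 : ℝ) + t * X v) μ := (integrable_const 1).add (hXint.const_mul t)
  have i2 : Integrable (fun v => 8 / t₀ ^ 2 * t ^ 2 * Real.exp (t₀ * |X v|)) μ := hint.const_mul _
  have i3 : Integrable (fun v => t * X v) μ := hXint.const_mul t
  calc ∫ v, Real.exp (t * X v) ∂μ
      ≤ ∫ v, (1 + t * X v + 8 / t₀ ^ 2 * t ^ 2 * Real.exp (t₀ * |X v|)) ∂μ :=
        integral_mono hexp_int hdom fun v => exp_mul_le_of_abs_le ht₀ ht (X v)
    _ = 1 + t * 0 + 8 / t₀ ^ 2 * t ^ 2 * ∫ v, Real.exp (t₀ * |X v|) ∂μ := by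
        rw [integral_add i1 i2, integral_add (integrable_const 1) i3, integral_const_mul,
          integral_const_mul, h0, integral_const]
        simp
    _ ≤ 1 + 8 * B / t₀ ^ 2 * t ^ 2 := by
        rw [mul_zero, add_zero]
        have : 8 / t₀ ^ 2 * t ^ 2 * ∫ v, Real.exp (t₀ * |X v|) ∂μ ≤ 8 / t₀ ^ 2 * t ^ 2 * B :=
          mul_le_mul_of_nonneg_left hB (by positivity)
        calc _ ≤ 1 + 8 / t₀ ^ 2 * t ^ 2 * B := by linarith
          _ = _ := by ring
    _ ≤ Real.exp (8 * B / t₀ ^ 2 * t ^ 2) := by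
        have := Real.add_one_le_exp (8 * B / t₀ ^ 2 * t ^ 2)
        linarith

end OneVariable

section Product

variable {ι : Type*} [Fintype ι] {V : Type*} [MeasurableSpace V]

/-- **One-sided Chernoff bound on a finite product.** On the product of probability spaces
`(V, μ i)`, for measurable centred `X i` with `∫ e^{t₀|Xᵢ|} dμᵢ ≤ B`: for `0 ≤ t ≤ t₀/2`,
`(⊗ μ) {n s ≤ ∑ᵢ Xᵢ(vᵢ)} ≤ exp(-n (t s - 8 B t²/t₀²))`, `n = card ι` (Markov's inequality for
`e^{t ∑ Xᵢ}` and the product structure `∫ ∏ e^{tXᵢ} = ∏ ∫ e^{tXᵢ}`). [folklore] -/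
theorem pi_measure_sum_ge_le_exp_of_le (μ : ι → Measure V) [∀ i, IsProbabilityMeasure (μ i)]
    (X : ι → V → ℝ) (hXm : ∀ i, AEStronglyMeasurable (X i) (μ i)) (h0 : ∀ i, ∫ v, X i v ∂μ i = 0)
    {t₀ B : ℝ} (ht₀ : 0 < t₀) (hint : ∀ i, Integrable (fun v => Real.exp (t₀ * |X i v|)) (μ i))
    (hB : ∀ i, ∫ v, Real.exp (t₀ * |X i v|) ∂μ i ≤ B) {t : ℝ} (ht : 0 ≤ t) (ht' : t ≤ t₀ / 2)
    (s : ℝ) :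
    Measure.pi μ {v | (Fintype.card ι : ℝ) * s ≤ ∑ i, X i (v i)} ≤
      ENNReal.ofReal (Real.exp (-(Fintype.card ι) * (t * s - 8 * B / t₀ ^ 2 * t ^ 2))) := by
  set n : ℕ := Fintype.card ι with hn
  have htabs : |t| ≤ t₀ / 2 := by rwa [abs_of_nonneg ht]
  -- integrability of each factor `e^{t Xᵢ}`
  have hfac : ∀ i, Integrable (fun v => Real.exp (t * X i v)) (μ i) := by
    intro i
    refine (hint i).mono' (Real.continuous_exp.comp_aestronglyMeasurable ((hXm i).const_mul t))
      (Eventually.of_forall fun v => ?_)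
    rw [Real.norm_eq_abs, abs_of_pos (Real.exp_pos _), Real.exp_le_exp]
    calc t * X i v ≤ |t * X i v| := le_abs_self _
      _ = |t| * |X i v| := abs_mul t _
      _ ≤ t₀ * |X i v| := mul_le_mul_of_nonneg_right (by linarith [abs_nonneg t]) (abs_nonneg _)
  -- the exponential of the sum is the product of the exponentials, integrable on the product
  have hprod : ∀ v : ι → V, Real.exp (t * ∑ i, X i (v i)) = ∏ i, Real.exp (t * X i (v i)) := by
    intro v
    rw [Finset.mul_sum, Real.exp_sum]
  have hSint : Integrable (fun v : ι → V => Real.exp (t * ∑ i, X i (v i))) (Measure.pi μ) := by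
    simp_rw [hprod]
    exact Integrable.fintype_prod (f := fun i w => Real.exp (t * X i w)) hfac
  -- Markov / Chernoff
  have hcher := measure_ge_le_exp_mul_mgf (μ := Measure.pi μ) (X := fun v : ι → V => ∑ i, X i (v i))
    ((n : ℝ) * s) ht hSint
  have hmgf : mgf (fun v : ι → V => ∑ i, X i (v i)) (Measure.pi μ) t ≤
      Real.exp (8 * B / t₀ ^ 2 * t ^ 2) ^ n := by
    rw [mgf]
    simp_rw [hprod]
    rw [integral_fintype_prod_eq_prod (f := fun i w => Real.exp (t * X i w)), hn,
      ← Finset.card_univ, ← Finset.prod_const]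
    refine Finset.prod_le_prod (fun i _ => integral_nonneg fun _ => (Real.exp_pos _).le)
      fun i _ => ?_
    exact integral_exp_mul_le_exp (μ i) (hXm i) ht₀ (hint i) (hB i) (h0 i) htabs
  have hreal : (Measure.pi μ).real {v | (n : ℝ) * s ≤ ∑ i, X i (v i)} ≤
      Real.exp (-(n : ℝ) * (t * s - 8 * B / t₀ ^ 2 * t ^ 2)) := by
    refine hcher.trans ?_
    calc Real.exp (-t * ((n : ℝ) * s)) * mgf (fun v : ι → V => ∑ i, X i (v i)) (Measure.pi μ) t
        ≤ Real.exp (-t * ((n : ℝ) * s)) * Real.exp (8 * B / t₀ ^ 2 * t ^ 2) ^ n :=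
          mul_le_mul_of_nonneg_left hmgf (Real.exp_pos _).le
      _ = Real.exp (-(n : ℝ) * (t * s - 8 * B / t₀ ^ 2 * t ^ 2)) := by
          rw [← Real.exp_nat_mul, ← Real.exp_add]
          ring_nf
  rw [← ofReal_measureReal]
  exact ENNReal.ofReal_le_ofReal hreal

/-- **One-sided Chernoff bound with the optimised rate.** Under the hypotheses of
`pi_measure_sum_ge_le_exp_of_le` and for `δ > 0`, `B > 0`:
`(⊗ μ) {n δ ≤ ∑ᵢ Xᵢ(vᵢ)} ≤ exp(-κ n)` with `κ = δ/2 · min(t₀/2, δ t₀²/(16 B))`. [folklore] -/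
theorem pi_measure_sum_ge_le_exp (μ : ι → Measure V) [∀ i, IsProbabilityMeasure (μ i)]
    (X : ι → V → ℝ) (hXm : ∀ i, AEStronglyMeasurable (X i) (μ i)) (h0 : ∀ i, ∫ v, X i v ∂μ i = 0)
    {t₀ B : ℝ} (ht₀ : 0 < t₀) (hBpos : 0 < B)
    (hint : ∀ i, Integrable (fun v => Real.exp (t₀ * |X i v|)) (μ i))
    (hB : ∀ i, ∫ v, Real.exp (t₀ * |X i v|) ∂μ i ≤ B) {δ : ℝ} (hδ : 0 < δ) :
    Measure.pi μ {v | (Fintype.card ι : ℝ) * δ ≤ ∑ i, X i (v i)} ≤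
      ENNReal.ofReal (Real.exp (-(min (t₀ / 2) (δ * t₀ ^ 2 / (16 * B)) * δ / 2) *
        Fintype.card ι)) := by
  set t : ℝ := min (t₀ / 2) (δ * t₀ ^ 2 / (16 * B)) with ht_def
  have ht0 : 0 ≤ t := le_min (by linarith) (by positivity)
  have ht' : t ≤ t₀ / 2 := min_le_left _ _
  have ht'' : t ≤ δ * t₀ ^ 2 / (16 * B) := min_le_right _ _
  refine (pi_measure_sum_ge_le_exp_of_le μ X hXm h0 ht₀ hint hB ht0 ht' δ).trans
    (ENNReal.ofReal_le_ofReal ?_)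
  rw [Real.exp_le_exp]
  -- `8 B t / t₀² ≤ δ/2`, so `t δ - 8 B t²/t₀² ≥ t δ/2`
  have hkey : 8 * B / t₀ ^ 2 * t ^ 2 ≤ t * δ / 2 := by
    have ht2 : 0 < t₀ ^ 2 := by positivity
    have h1 : 8 * B / t₀ ^ 2 * t ≤ δ / 2 := by
      rw [div_mul_eq_mul_div, div_le_iff₀ ht2]
      rw [le_div_iff₀ (by positivity)] at ht''
      linarith
    calc 8 * B / t₀ ^ 2 * t ^ 2 = (8 * B / t₀ ^ 2 * t) * t := by ring
      _ ≤ δ / 2 * t := mul_le_mul_of_nonneg_right h1 ht0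
      _ = t * δ / 2 := by ring
  have hn : (0 : ℝ) ≤ Fintype.card ι := Nat.cast_nonneg _
  nlinarith

/-- **Two-sided Chernoff bound for an average of independent centred variables with uniform
exponential moments.** On the product of the probability spaces `(V, μ i)`, for measurable
centred `X i` with `∫ e^{t₀|Xᵢ|} dμᵢ ≤ B` (`t₀, B > 0`) and `δ > 0`:
`(⊗ μ) {δ ≤ |n⁻¹ ∑ᵢ Xᵢ(vᵢ)|} ≤ 2 exp(-κ n)`, `n = card ι`, with
`κ = δ/2 · min(t₀/2, δ t₀²/(16 B))`. [folklore] -/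
theorem pi_measure_avg_abs_ge_le_exp (μ : ι → Measure V) [∀ i, IsProbabilityMeasure (μ i)]
    (X : ι → V → ℝ) (hXm : ∀ i, AEStronglyMeasurable (X i) (μ i)) (h0 : ∀ i, ∫ v, X i v ∂μ i = 0)
    {t₀ B : ℝ} (ht₀ : 0 < t₀) (hBpos : 0 < B)
    (hint : ∀ i, Integrable (fun v => Real.exp (t₀ * |X i v|)) (μ i))
    (hB : ∀ i, ∫ v, Real.exp (t₀ * |X i v|) ∂μ i ≤ B) {δ : ℝ} (hδ : 0 < δ) [Nonempty ι] :
    Measure.pi μ {v | δ ≤ |(Fintype.card ι : ℝ)⁻¹ * ∑ i, X i (v i)|} ≤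
      ENNReal.ofReal (2 * Real.exp (-(min (t₀ / 2) (δ * t₀ ^ 2 / (16 * B)) * δ / 2) *
        Fintype.card ι)) := by
  set n : ℕ := Fintype.card ι with hn
  have hnpos : (0 : ℝ) < n := by exact_mod_cast Fintype.card_pos
  set κ : ℝ := min (t₀ / 2) (δ * t₀ ^ 2 / (16 * B)) * δ / 2 with hκ
  -- the event splits into the two one-sided events
  have hsub : {v : ι → V | δ ≤ |(n : ℝ)⁻¹ * ∑ i, X i (v i)|} ⊆
      {v | (n : ℝ) * δ ≤ ∑ i, X i (v i)} ∪ {v | (n : ℝ) * δ ≤ ∑ i, (-X i (v i))} := by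
    intro v hv
    simp only [mem_setOf_eq, mem_union] at hv ⊢
    rw [abs_mul, abs_inv, abs_of_pos hnpos, le_inv_mul_iff₀ hnpos] at hv
    rcases le_abs.1 hv with h | h
    · exact Or.inl h
    · right
      rw [Finset.sum_neg_distrib]
      exact h
  -- hypotheses for `-X`
  have hXm' : ∀ i, AEStronglyMeasurable (fun v => -X i v) (μ i) := fun i => (hXm i).neg
  have h0' : ∀ i, ∫ v, -X i v ∂μ i = 0 := fun i => by rw [integral_neg, h0 i, neg_zero]
  have hint' : ∀ i, Integrable (fun v => Real.exp (t₀ * |-X i v|)) (μ i) := fun i => by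
    simp_rw [abs_neg]; exact hint i
  have hB' : ∀ i, ∫ v, Real.exp (t₀ * |-X i v|) ∂μ i ≤ B := fun i => by
    simp_rw [abs_neg]; exact hB i
  have h1 := pi_measure_sum_ge_le_exp μ X hXm h0 ht₀ hBpos hint hB hδ
  have h2 := pi_measure_sum_ge_le_exp μ (fun i v => -X i v) hXm' h0' ht₀ hBpos hint' hB' hδ
  calc Measure.pi μ {v | δ ≤ |(n : ℝ)⁻¹ * ∑ i, X i (v i)|}
      ≤ Measure.pi μ ({v | (n : ℝ) * δ ≤ ∑ i, X i (v i)} ∪ {v | (n : ℝ) * δ ≤ ∑ i, (-X i (v i))}) :=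
        measure_mono hsub
    _ ≤ Measure.pi μ {v | (n : ℝ) * δ ≤ ∑ i, X i (v i)} +
        Measure.pi μ {v | (n : ℝ) * δ ≤ ∑ i, (-X i (v i))} := measure_union_le _ _
    _ ≤ ENNReal.ofReal (Real.exp (-κ * n)) + ENNReal.ofReal (Real.exp (-κ * n)) :=
        add_le_add h1 h2
    _ = ENNReal.ofReal (2 * Real.exp (-κ * n)) := by
        rw [← ENNReal.ofReal_add (Real.exp_pos _).le (Real.exp_pos _).le, two_mul]

end Product

section LocalGibbs

open Literature.Analysis.FluidPDE Literature.MathematicalPhysics.KineticTheory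

variable {a₀ θ₀ : T3 → ℝ} {u₀ : T3 → V3}

/-- **Velocity fluctuations are exponentially small.** For a jointly measurable family of
per-particle velocity observables `Y x : ℝ³ → ℝ` which, under `N(u₀(x), θ₀(x))`, are centred and
have a uniform exponential moment `∫ e^{t₀|Y x|} ≤ B`, and a continuous `χ` with `|χ| ≤ C`: the
local Gibbs probability that `|(N+1)⁻¹ ∑ᵢ χ(xᵢ) Y(xᵢ, vᵢ)| ≥ δ` is at most `2 e^{-κ (N+1)}` with
`κ = δ/2 · min(t₁/2, δ t₁²/(16 B))`, `t₁ = t₀ / max C 1` (conditionally on the positions the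
velocities are independent Gaussians, `lintegral_localGibbsMeasure`; Chernoff bound
`pi_measure_avg_abs_ge_le_exp`). Exponential analogue of `localGibbsMeasure_velFluct_le`.
[folklore] -/
theorem localGibbsMeasure_velFluct_le_exp (ha : Continuous a₀) (hθ : Continuous θ₀)
    (hu : Continuous u₀) (ha0 : ∀ x, 0 ≤ a₀ x) (hθ0 : ∀ x, 0 < θ₀ x) (σ : ℝ) (N : ℕ)
    [IsProbabilityMeasure (localGibbsMeasure σ a₀ u₀ θ₀ N)]
    {Y : T3 → V3 → ℝ} (hYm : Measurable fun p : T3 × V3 => Y p.1 p.2)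
    (hY0 : ∀ x, ∫ v, Y x v ∂gaussMeasure (u₀ x) (θ₀ x) = 0)
    {t₀ B : ℝ} (ht₀ : 0 < t₀) (hBpos : 0 < B)
    (hYint : ∀ x, Integrable (fun v => Real.exp (t₀ * |Y x v|)) (gaussMeasure (u₀ x) (θ₀ x)))
    (hYB : ∀ x, ∫ v, Real.exp (t₀ * |Y x v|) ∂gaussMeasure (u₀ x) (θ₀ x) ≤ B)
    {χ : T3 → ℝ} (hχ : Continuous χ) {C : ℝ} (hC : ∀ x, |χ x| ≤ C)
    {δ : ℝ} (hδ : 0 < δ) :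
    localGibbsMeasure σ a₀ u₀ θ₀ N
        {z | δ ≤ |((N + 1 : ℕ) : ℝ)⁻¹ * ∑ i, χ (z i).1 * Y (z i).1 (z i).2|} ≤
      ENNReal.ofReal (2 * Real.exp (-(min (t₀ / max C 1 / 2)
        (δ * (t₀ / max C 1) ^ 2 / (16 * B)) * δ / 2) * ((N + 1 : ℕ) : ℝ))) := by
  set t₁ : ℝ := t₀ / max C 1 with ht₁
  have hC1 : 0 < max C 1 := lt_max_of_lt_right one_pos
  have ht₁pos : 0 < t₁ := div_pos ht₀ hC1
  set A := {z : Config (N + 1) (Fin 3) T3 |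
    δ ≤ |((N + 1 : ℕ) : ℝ)⁻¹ * ∑ i, χ (z i).1 * Y (z i).1 (z i).2|} with hA
  have hFm : Measurable fun z : Config (N + 1) (Fin 3) T3 =>
      ((N + 1 : ℕ) : ℝ)⁻¹ * ∑ i, χ (z i).1 * Y (z i).1 (z i).2 := by
    refine measurable_const.mul (Finset.measurable_sum _ fun i _ => ?_)
    exact (hχ.measurable.comp (measurable_pi_apply i).fst).mul
      (hYm.comp (measurable_pi_apply i))
  have hAm : MeasurableSet A := measurableSet_le measurable_const hFm.abs
  -- the per-particle variables `χ(xᵢ) Y(xᵢ, ·)` have the uniform exponential moment at `t₁`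
  have hdom : ∀ (x : T3) (v : V3), t₁ * |χ x * Y x v| ≤ t₀ * |Y x v| := by
    intro x v
    rw [abs_mul, ← mul_assoc]
    refine mul_le_mul_of_nonneg_right ?_ (abs_nonneg _)
    calc t₁ * |χ x| ≤ t₁ * max C 1 :=
          mul_le_mul_of_nonneg_left ((hC x).trans (le_max_left _ _)) ht₁pos.le
      _ = t₀ := div_mul_cancel₀ t₀ hC1.ne'
  have hXm : ∀ x : T3, AEStronglyMeasurable (fun v => χ x * Y x v) (gaussMeasure (u₀ x) (θ₀ x)) :=
    fun x => ((hYm.comp (measurable_const.prodMk measurable_id)).const_mul (χ x)).aestronglyMeasurable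
  have hXint : ∀ x : T3,
      Integrable (fun v => Real.exp (t₁ * |χ x * Y x v|)) (gaussMeasure (u₀ x) (θ₀ x)) := by
    intro x
    refine (hYint x).mono' ?_ (Eventually.of_forall fun v => ?_)
    · exact Real.continuous_exp.comp_aestronglyMeasurable ((hXm x).norm.const_mul t₁)
    · rw [Real.norm_eq_abs, abs_of_pos (Real.exp_pos _), Real.exp_le_exp]
      exact hdom x v
  have hXB : ∀ x : T3, ∫ v, Real.exp (t₁ * |χ x * Y x v|) ∂gaussMeasure (u₀ x) (θ₀ x) ≤ B := by
    intro x
    refine le_trans (integral_mono (hXint x) (hYint x) fun v => ?_) (hYB x)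
    exact Real.exp_le_exp.2 (hdom x v)
  have hX0 : ∀ x : T3, ∫ v, χ x * Y x v ∂gaussMeasure (u₀ x) (θ₀ x) = 0 := fun x => by
    rw [integral_const_mul, hY0, mul_zero]
  -- conditional (velocity) bound, uniformly in the positions
  have hvel : ∀ x : Fin (N + 1) → T3,
      velMeasure u₀ θ₀ x {v | zipConfig (x, v) ∈ A} ≤
        ENNReal.ofReal (2 * Real.exp (-(min (t₁ / 2) (δ * t₁ ^ 2 / (16 * B)) * δ / 2) *
          ((N + 1 : ℕ) : ℝ))) := by
    intro x
    have h := pi_measure_avg_abs_ge_le_exp (fun i => gaussMeasure (u₀ (x i)) (θ₀ (x i)))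
      (fun i w => χ (x i) * Y (x i) w) (fun i => hXm (x i)) (fun i => hX0 (x i)) ht₁pos hBpos
      (fun i => hXint (x i)) (fun i => hXB (x i)) hδ
    simpa [velMeasure, hA, Fintype.card_fin] using h
  calc localGibbsMeasure σ a₀ u₀ θ₀ N A
      = ∫⁻ z, A.indicator 1 z ∂localGibbsMeasure σ a₀ u₀ θ₀ N := (lintegral_indicator_one hAm).symm
    _ = ∫⁻ x, ENNReal.ofReal ((canonicalPartition (Torus.geometry (Fin 3)) (hsDiameter σ N)
          (N + 1) (localGibbsProfile a₀ u₀ θ₀))⁻¹ * posWeight a₀ (hsDiameter σ N) (N + 1) x) *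
          velMeasure u₀ θ₀ x {v | zipConfig (x, v) ∈ A} := by
        rw [lintegral_localGibbsMeasure ha hθ hu ha0 hθ0 σ N (measurable_one.indicator hAm)]
        refine lintegral_congr fun x => ?_
        congr 1
        have hpre : MeasurableSet {v : Fin (N + 1) → V3 | zipConfig (x, v) ∈ A} :=
          hAm.preimage (measurable_zipConfig.comp (measurable_const.prodMk measurable_id))
        rw [← lintegral_indicator_one hpre]
        rfl
    _ ≤ ∫⁻ x, ENNReal.ofReal ((canonicalPartition (Torus.geometry (Fin 3)) (hsDiameter σ N)
          (N + 1) (localGibbsProfile a₀ u₀ θ₀))⁻¹ * posWeight a₀ (hsDiameter σ N) (N + 1) x) *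
          ENNReal.ofReal (2 * Real.exp (-(min (t₁ / 2) (δ * t₁ ^ 2 / (16 * B)) * δ / 2) *
            ((N + 1 : ℕ) : ℝ))) :=
        lintegral_mono fun x => mul_le_mul_right (hvel x) _
    _ = ENNReal.ofReal (2 * Real.exp (-(min (t₁ / 2) (δ * t₁ ^ 2 / (16 * B)) * δ / 2) *
            ((N + 1 : ℕ) : ℝ))) := by
        have hρm : Measurable fun x : Fin (N + 1) → T3 => ENNReal.ofReal
            ((canonicalPartition (Torus.geometry (Fin 3)) (hsDiameter σ N) (N + 1)
              (localGibbsProfile a₀ u₀ θ₀))⁻¹ * posWeight a₀ (hsDiameter σ N) (N + 1) x) :=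
          (measurable_const.mul (measurable_posWeight ha _ _)).ennreal_ofReal
        rw [lintegral_mul_const _ hρm, lintegral_posWeight_eq_one ha hθ hu ha0 hθ0 σ N, one_mul]

end LocalGibbs

end LocalGibbsConcentration

end Summit.AtomisticToContinuum.HydrodynamicLimit.Theorems
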